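import Summits.CriticalPhenomena.PercolationContinuityZ3.Theorems.Transplant.SkelFrmQuasi1ChoiceLTKPx
import Summits.CriticalPhenomena.PercolationContinuityZ3.Theorems.Transplant.PlanarSkeletonFrmFrom1Px
import Summits.CriticalPhenomena.PercolationContinuityZ3.Theorems.Transplant.PlanarSkeletonFrmQuasi1
import Summits.CriticalPhenomena.PercolationContinuityZ3.Theorems.Transplant.PlanarSkeletonFrmQuasiDefs
import Summits.CriticalPhenomena.PercolationContinuityZ3.Theorems.Transplant.PlanarSkeletonFrmQuasiProxies
import Summits.CriticalPhenomena.PercolationContinuityZ3.Theorems.Transplant.SkelFrmQuasi1ChoiceDefsPx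
import HarnessLib

/-!
# GEN-Q PORT (WAVE-Q table v0.8 section 2, row G238, U-level ?; captain R-6/R-7 2026-08-27: carrier token swap `PlanarSkeletonFrmFrom ↦ PlanarSkeletonFrmQuasi`)
# of the tree module «Transplant/PlanarSkeletonFrmFrom1Px» (sha256 6e47763831a7cf30…) onto the quasi-step carrier `PlanarSkeletonFrmQuasi` (p507026): «PlanarSkeletonFrmQuasi1Px»

ORIGINAL TITLE: 

builds on p205010 (kernel theorem, internal audit signed; external expert review pending) — nothing in this file uses p205010; NOTHING is claimed about any open node
((N3-b), the end state).  Lane `prim-bschramm`, seat `prim-bschramm-gen-1` (gen 4; binder-wave captain).  Helper file (`--supports stmt-CriticalPhenomena-4575 --as helper`).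
PORT RULES (U-wave r1–r4 re-used, GEN-Q hunk classes of p3-g29 #6136): declaration order, names and proof texts are those of «PlanarSkeletonFrmFrom1Px», byte-identical except
(i) the carrier token `PlanarSkeletonFrmFrom ↦ PlanarSkeletonFrmQuasi` in binders, `namespace`/`end` lines and qualified names (module names `SkelFrmFrom… ↦ SkelFrmQuasi…`
in imports of already-ported rows); (ii) `Φ.step ↦ Φ.qstep` with the called Steps lemma replaced by its `…Q`/`_q` twin and the cost `Φ.M` threaded (none in this file unless
listed below); (iii) `Φ.cyl_connected ↦ Φ.cyl_reach` readers (none unless listed); (iv) graph-ball radii / window floors ×`Φ.M` (none unless listed).  Carrier-free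
residents stay imported/exported from the original «PlanarSkeletonFrm1Px» exactly as in the FrmFrom port.  Docstrings and citations are the original's.

-/

noncomputable section

namespace Summit.CriticalPhenomena.PercolationContinuityZ3.Theorems.Transplant

open MeasureTheory Literature.Probability.Percolation Literature.Probability.LatticeModels SimpleGraph
open Literature.Barriers.CriticalPhenomena (IsQuasiTransitive IsGraphAmenable HasExponentialGrowth
  hasExponentialGrowth_of_not_isGraphAmenable BurtonKeane1989_atMostOneInfiniteCluster_holds Hutchcroft2016_noPercolationAtCriticality_holds
  countable_of_connected_of_locallyFinite)
open scoped Classical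

/-! ## §1 Percolation plumbing at one vertex: the drop from `θ(p_c) = 0` -/

-- GEN-Q: carrier-free resident `.drop_at_of_critical` lives in the FrmFrom module (same namespace) — not re-declared.

/-! ## §2 Multi-type carrier with proxies: `θ_t(p_c) = 0` and the drop, from the four GEN column obligations -/

namespace PlanarSkeletonFrmQuasi

open SkelConc (Consts)

variable {V : Type} {G : SimpleGraph V} [G.LocallyFinite]

/-- **CONTINUITY AT `p_c` AT A BASE TYPE WITH PROXIES, from the GEN column obligations** (GEN twin of U's `…_iff_minimal'`/`…_of_subexponential_case'` ∘ the closure):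
let `𝒞₀` be a GEN choice function at proxy radius `D` meeting `GeomHoldsNQFnPxAt`, `RootHoldsNQWFnLKPxAt Lf Kmin`, `FaceHoldsRNQFnLTKPxAt Lf dT Kmin`, `ReachHoldsRHNQFnLKPxAt Lf Kmin`;
then on every locally finite `G` with a `PlanarSkeletonFrmQuasi Φ`, every base vertex `t ∈ Φ.types` with `Φ.HasProxies t D` and subcritical cylinders at `p_c` has `θ_t(p_c) = 0`
— exponential growth: Hutchcroft (connected by `graph_connected`, quasi-transitive by the frames); otherwise the GEN closure top `drop_of_choiceFnNQLTKPx_at` at `p_c` with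
`0 < p_c` (`pos_of_theta_pos`), `p_c < 1` (`criticalProb_lt_one`) and Burton–Keane uniqueness (`numInfiniteClusters_le_one`), closed by `theta_criticalProbIOf_eq_zero_of_drop_at`.
[cite: BenjaminiSchramm1996, Conj. 4] [cite: Hutchcroft2016, Thm. 1] [cite: LyonsPeres2016, Thm. 7.6] [cite: KozmaNitzan2024, §4 Theorem 6] -/
theorem theta_criticalProbIOf_eq_zero_of_choiceFnNQLTKPxAt (Lf : ℕ → ℕ) (dT : ℝ → ℝ) (hdT : ∀ x : ℝ, 0 < x → 0 < dT x) (Kmin : ℕ) {D : ℕ}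
    (𝒞₀ : ChoiceFnNQPxAt D) (hGm : GeomHoldsNQFnPxAt 𝒞₀) (hR : RootHoldsNQWFnLKPxAt Lf Kmin 𝒞₀)
    (hF : FaceHoldsRNQFnLTKPxAt Lf dT Kmin 𝒞₀) (hRe : ReachHoldsRHNQFnLKPxAt Lf Kmin 𝒞₀)
    (Φ : PlanarSkeletonFrmQuasi G) {t : V} (ht : t ∈ Φ.types) (hP : Φ.HasProxies t D) (hC : Φ.CylSubcritical (criticalProbIOf G t)) :
    theta G t (criticalProbIOf G t) = 0 := by
  haveI : Countable V := countable_of_connected_of_locallyFinite G (Φ.graph_connected t) t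
  by_cases hg : HasExponentialGrowth G
  · exact Hutchcroft2016_noPercolationAtCriticality_holds G (Φ.graph_connected t) Φ.isQuasiTransitive_frmQuasi hg t
  · exact theta_criticalProbIOf_eq_zero_of_drop_at G t fun hθ =>
      drop_of_choiceFnNQLTKPx_at Lf dT hdT Kmin 𝒞₀ hGm hR hF hRe Φ hg ht hP _ (PlanarSkeletonSign.pos_of_theta_pos hθ) (Φ.criticalProb_lt_one t)
        (Φ.numInfiniteClusters_le_one hg ht _) hC hθ

-- GEN-Q (R-2, captain 2026-08-27): `PlanarSkeletonFrmFrom.drop_of_choiceFnNQLTKPxAt_at` is not in the used cone of the node top — not ported.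

end PlanarSkeletonFrmQuasi

/-! ## §3 One-type SCALED skeletons with `L ≤ N`: through the coarse skeleton and its proxies -/

namespace PlanarSkeletonFrmScaled

open PlanarSkeletonFrmQuasi (ChoiceFnNQPxAt GeomHoldsNQFnPxAt RootHoldsNQWFnLKPxAt FaceHoldsRNQFnLTKPxAt ReachHoldsRHNQFnLKPxAt)

variable {V : Type} {G : SimpleGraph V} [G.LocallyFinite]

-- GEN-Q (R-2, captain 2026-08-27): `PlanarSkeletonFrmScaled.theta_criticalProbIOf_eq_zero_of_choiceFnNQLTKPxAt` is not in the used cone of the node top — not ported.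

-- GEN-Q (R-2, captain 2026-08-27): `PlanarSkeletonFrmScaled.drop_of_choiceFnNQLTKPxAt_at` is not in the used cone of the node top — not ported.

end PlanarSkeletonFrmScaled

end Summit.CriticalPhenomena.PercolationContinuityZ3.Theorems.Transplant

end
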